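import Summits.RiemannHypothesis.RiemannHypothesis.Theorems.WeilWindowFlowGronwallLeakageMaximalFlow
import Summits.RiemannHypothesis.RiemannHypothesis.Theorems.WeilWindowFlowGronwallLeakageStrictAnti
import Summits.RiemannHypothesis.RiemannHypothesis.Theorems.GronwallLeakage.Negative.Structure
import Summits.RiemannHypothesis.RiemannHypothesis.Theorems.WeilWindowFlowGronwallLeakageIffWeilPos
import Literature.NumberTheory.LFunctions.WeilFirstPrimePositivityC
import Literature.NumberTheory.LFunctions.WeilTwoPrimeCertificate
import HarnessLib.Audit

/-!
# Line `exact-rung-log2` — the NEXT RUNG of the head-window ladder under crux `GronwallLeakage`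

Crux `Summit.RiemannHypothesis.RiemannHypothesis.Theses.WeilWindowFlow.GronwallLeakage`
(item stmt-RiemannHypothesis-1037; `X ↔ RH` landed: `gronwallLeakage_iff_riemannHypothesis`, p90753;
`X ↔ ∀ a > 0, WeilPositivityOn a` landed: `gronwallLeakage_iff_uniformWeilPositivity`, p95911).
Forward generator G4 `ladder-down`, seat planner-fwd-ladder-RiemannHypothesis-50-0 (2026-08-17).

GRADATION (the crux's own language: the window half-length `A` of the flow `a ↦ ε(a)`):
`HeadRung A := WeilPositivityOn A` (`⟺ 0 ≤ ε(A)` ⟺ no conjugate point of the flow in `(0, A]`),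
antitone in `A` (`headRung_antitone`), `X ⟺ ∀ A > 0, HeadRung A`, `S = RH` at `A = ∞`.

* FLOOR (proved, in tree, beyond print): `HeadRung (log 3 / 2)` =
  `Literature.NumberTheory.LFunctions.weilPositivityOn_log_three_half` (Stage-C kernel certificate
  `weilCert3C`, first prime inside the window; print floor Yoshida 1992 Thm 1: `(log 2)/2`).
  In flight (not this line): `WeilPositivityOn (59/100)` (two-prime FULL positivity certificate
  `weilCert23P`, files `WeilTwoPrimePos59Data*`, prover of stmt-RiemannHypothesis-1526).
* NEXT RUNG (this line's first stub, `stub_headRung_log2 : NextRung`): `HeadRung (log 2)` — the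
  maximal TWO-PRIME window (`supp (g ⋆ g̃) ⊆ [-log 4, log 4]`: the prime powers 2, 3 inside, 4 on
  the boundary). Not an item of any route; consumed by `Cruxes/WeilposSlackRungLog2/StrategistR1.lean`
  (`rung_of_exactRung`: it closes WeilPos's crux stmt-18182), by SpectralTrace's `unitMargin_two_iff`
  (`U(2) = WindowTraceArch → WeilPositivityOn (log 2)`), and it is the window PluckedString /
  WeilGroundState step through next.
* RESIDUAL (declared, RH-strength GIVEN the rung; second stub `stub_tailLeakage_log2 : ResidualLog2`):
  the crux's own leakage law restricted to base windows `b ≥ log 2`. Kernel certificate below: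
  `residual_iff : ResidualLog2 ↔ (NextRung → RH)` and `nextRung_and_residual_iff : NextRung ∧ ResidualLog2 ↔ RH`
  (F8 conjunct split: the attacked conjunct is `NextRung`).
* COMPOSITION (sorry-free, genuine Grönwall transport, not a one-liner):
  `GronwallLeakage_of : NextRung → ResidualLog2 → GronwallLeakage`.
* ATTACK on the rung (§5): `nextRung_iff_twoPrime` (landed reduction to the two-prime analytic form
  `E₂₃ = weilTwoPrimeQuadratic ≥ 0` on `C(log 2)`), `nextRung_of_twoPrime_on` (any `b ≥ log 2` will do —
  `E₂₃` is defined for every test function, so a RATIONAL enclosure `b = 355/512 > log 2` is admissible,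
  exactly as the floor used `b = 563/1024 > (log 3)/2`), `nextRung_of_cert` (one `WeilCert23` instance with
  `check = true` and `b ≥ log 2` closes the stub; proved-sound format, [Yoshida1992, §6, Thm 1 p. 310]).
  Where the floor proof stops: `weilQuadratic_eq_weilFirstPrimeQuadratic` needs `tsupport g ⊆ [-(log 3)/2, (log 3)/2]`;
  on `C(log 2)` the `n = 3` terms `(log 3/√3)·2Re (g⋆g̃)(±log 3)` enter at size `O(‖g‖₂²)` while the bottom drops
  from `5.6·10⁻⁸` (μ = e^{2A} = 3) to `≈ 7.7·10⁻¹³` (μ = 4; kit j013450, Cruxes/GronwallLeakage evidence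
  results-j013450-N56.json); the relaxed (level-capped beyond the frequency cut-off `T`) bottom of the
  Yoshida format kept ≈ 50 % of the true bottom at `b = 59/100, 63/100` with `T = 80`
  (Cruxes/GroundStateSimpleEven/Lines/parity_multiplicity_commutator.lean, v7 numerics) — whether `T ≈ 80–160`,
  `N ≈ 170–260` still leaves a positive relaxed bottom at `b = 355/512` is the line's cheapest falsifier.

§3–§4 copy, with attribution, the sorry-free §F2 of `Cruxes/GronwallLeakage/DecompCensus.lean`
(planner-cstrat-stmt-RiemannHypothesis-1037-r1-0), so that this file is self-contained.
`sorry` occurs ONLY inside `stub_headRung_log2` and `stub_tailLeakage_log2`.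
-/

set_option linter.dupNamespace false

noncomputable section

open MeasureTheory Set Filter Topology
open Literature.NumberTheory.LFunctions
open Summit.RiemannHypothesis.RiemannHypothesis.Theses.WeilWindowFlow (GronwallLeakage)
open Summit.RiemannHypothesis.RiemannHypothesis.Theorems.WeilWindowFlowGronwallLeakage
open Summit.RiemannHypothesis.Cruxes.GronwallLeakage.Negative

namespace Summit.RiemannHypothesis.RiemannHypothesis.Cruxes.GronwallLeakage.ExactRungLog2

local notation "ε" => weilGroundEnergy

/-! ## §1 The rung family, the next rung, the residual -/

/-- **Rung family (head window).** Weil positivity on the one window `[-A, A]`: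
`Re W(g ⋆ g̃) ≥ 0` for every Weil test function supported in `[-A, A]`. -/
def HeadRung (A : ℝ) : Prop := WeilPositivityOn A

/-- **The next rung** (first stub of the line): the maximal two-prime window `A = log 2 = (log 4)/2`. -/
def NextRung : Prop := HeadRung (Real.log 2)

/-- **Tail leakage from base `a₁`**: the crux's Grönwall law for base windows `b ≥ a₁` only. -/
def TailLeakage (a₁ : ℝ) : Prop :=
  ∃ C : ℝ → ℝ, ∀ b a : ℝ, a₁ ≤ b → b ≤ a →
    IntervalIntegrable C volume b a ∧ ε b * Real.exp (-(∫ x in b..a, C x)) ≤ ε a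

/-- **The declared residual** of the line (second stub): tail leakage from the base `log 2`. -/
def ResidualLog2 : Prop := TailLeakage (Real.log 2)

theorem nextRung_iff : NextRung ↔ WeilPositivityOn (Real.log 2) := Iff.rfl

/-! ## §2 Floor witness and monotonicity (F3) -/

/-- **FLOOR (proved in tree):** the rung family specialises to the landed first-prime certificate. -/
theorem headRung_floor : HeadRung (Real.log 3 / 2) := weilPositivityOn_log_three_half

/-- The rung family is antitone in the window: a larger window is the harder rung. -/
theorem headRung_antitone {A B : ℝ} (hAB : A ≤ B) (hB : HeadRung B) : HeadRung A :=
  WeilPositivityOn.mono hAB hB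

/-- Every window up to the floor is settled. -/
theorem headRung_of_le_floor {A : ℝ} (hA : A ≤ Real.log 3 / 2) : HeadRung A :=
  headRung_antitone hA headRung_floor

/-- The next rung gives back the floor (sanity: `(log 3)/2 ≤ log 2`). -/
theorem headRung_floor_of_nextRung (h : NextRung) : HeadRung (Real.log 3 / 2) := by
  refine headRung_antitone ?_ h
  have h3 : Real.log 3 < Real.log 4 := Real.log_lt_log (by norm_num) (by norm_num)
  have h4 : Real.log 4 = 2 * Real.log 2 := by
    rw [show (4 : ℝ) = 2 ^ 2 by norm_num, Real.log_pow]; push_cast; ring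
  linarith

/-! ## §3 The two registered stubs -/

/-- **STUB 1 (the attacked rung, RH-implied, RH-free certifiable):** Weil positivity on `[-log 2, log 2]`. -/
theorem stub_headRung_log2 : NextRung := by
  sorry

/-- **STUB 2 (DECLARED RESIDUAL, RH-strength given stub 1 — `residual_iff`):** the leakage law of the
crux for base windows `b ≥ log 2`. -/
theorem stub_tailLeakage_log2 : ResidualLog2 := by
  sorry

/-! ## §4 Composition: rung + residual ⟹ crux (Grönwall transport; after DecompCensus §F2) -/

/-- **Head + tail ⟹ `ε ≥ 0` at every window.** On `(0, a₁]` from the head by monotonicity of the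
cones, on `[a₁, ∞)` by transporting `ε a₁ ≥ 0` with the tail law (Grönwall step). -/
theorem forall_nonneg_of_head_tail {a₁ : ℝ} (ha₁ : 0 < a₁) (hH : HeadRung a₁)
    (hT : TailLeakage a₁) : ∀ a : ℝ, 0 < a → 0 ≤ ε a := by
  intro a ha
  by_cases hle : a ≤ a₁
  · exact (weilGroundEnergy_nonneg_iff_holds ha).2 (WeilPositivityOn.mono hle hH)
  · have hlt : a₁ ≤ a := le_of_lt (lt_of_not_ge hle)
    have h0 : 0 ≤ ε a₁ := (weilGroundEnergy_nonneg_iff_holds ha₁).2 hH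
    obtain ⟨C, hC⟩ := hT
    exact le_trans (mul_nonneg h0 (Real.exp_pos _).le) (hC a₁ a le_rfl hlt).2

/-- **THE LINE'S COMPOSITION** (kernel-checked, no `sorry`; the FIRST theorem of this file concluding the
crux, hypotheses = exactly the two stub statements): next rung + residual ⟹ `GronwallLeakage`
(`ε ≥ 0` everywhere by `forall_nonneg_of_head_tail`, then Yoshida's criterion and `X ↔ RH`, both landed). -/
theorem GronwallLeakage_of : NextRung → ResidualLog2 → GronwallLeakage :=
  fun hH hT ↦ gronwallLeakage_iff_riemannHypothesis.2
    (riemannHypothesis_iff_forall_weilPositivityOn.2 fun a ha ↦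
      (weilGroundEnergy_nonneg_iff_holds ha).1
        (forall_nonneg_of_head_tail (Real.log_pos one_lt_two) hH hT a ha))

/-- Hypothesis-free form: the crux from the two registered stubs (uses `sorry` only through them). -/
theorem gronwallLeakage_of_stubs : GronwallLeakage :=
  GronwallLeakage_of stub_headRung_log2 stub_tailLeakage_log2

/-- `ε ≥ 0` at every window gives the crux (Yoshida's criterion + `X ↔ RH`, both landed). -/
theorem gronwallLeakage_of_forall_nonneg (h : ∀ a : ℝ, 0 < a → 0 ≤ ε a) : GronwallLeakage :=
  gronwallLeakage_iff_riemannHypothesis.2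
    (riemannHypothesis_iff_forall_weilPositivityOn.2 fun a ha ↦
      (weilGroundEnergy_nonneg_iff_holds ha).1 (h a ha))

/-- **Head + tail ⟹ crux** at a general base window `a₁ > 0` (used in §5). -/
theorem gronwallLeakage_of_head_tail {a₁ : ℝ} (ha₁ : 0 < a₁) (hH : HeadRung a₁)
    (hT : TailLeakage a₁) : GronwallLeakage :=
  gronwallLeakage_of_forall_nonneg (forall_nonneg_of_head_tail ha₁ hH hT)

/-! ## §5 On-path, converse and the residual's certificate (F4, F8) -/

/-- `X` gives the tail at every base (restriction of the witness). -/
theorem tailLeakage_of_gronwallLeakage {a₁ : ℝ} (ha₁ : 0 < a₁) (hX : GronwallLeakage) :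
    TailLeakage a₁ := by
  obtain ⟨C, hC⟩ := hX
  exact ⟨C, fun b a hb hba ↦ hC b a (ha₁.trans_le hb) hba⟩

/-- ON-PATH: the crux gives every head rung. -/
theorem headRung_of_gronwallLeakage (hX : GronwallLeakage) {A : ℝ} (hA : 0 < A) : HeadRung A :=
  gronwallLeakage_iff_uniformWeilPositivity.1 hX A hA

/-- ON-PATH: `GronwallLeakage → NextRung`. -/
theorem nextRung_of_gronwallLeakage (hX : GronwallLeakage) : NextRung :=
  headRung_of_gronwallLeakage hX (Real.log_pos one_lt_two)

/-- CONVERSE (expected, F4): `RH → NextRung` — rungs are consequences of the summit; the other end is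
pinned to the proved floor `headRung_floor`. -/
theorem nextRung_of_riemannHypothesis (h : _root_.RiemannHypothesis) : NextRung :=
  riemannHypothesis_iff_forall_weilPositivityOn.1 h _ (Real.log_pos one_lt_two)

/-- ON-PATH for the residual: `GronwallLeakage → ResidualLog2`. -/
theorem residual_of_gronwallLeakage (hX : GronwallLeakage) : ResidualLog2 :=
  tailLeakage_of_gronwallLeakage (Real.log_pos one_lt_two) hX

/-- Log-AC on the negative side: on `[b, a] ⊂ (0, ∞)` with `ε b < 0`, `x ↦ log (-ε x)` is absolutely
continuous (`ε` is AC unconditionally, antitone with values in `(-∞, ε b]`, and `y ↦ log (-y)` is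
`|ε b|⁻¹`-Lipschitz there). [DecompCensus §F2] -/
theorem logNegAC_of_neg_left {b a : ℝ} (hb : 0 < b) (hba : b ≤ a) (hεb : ε b < 0) :
    AbsolutelyContinuousOnInterval (fun x ↦ Real.log (-ε x)) b a := by
  have hpos : 0 < -ε b := neg_pos.2 hεb
  have hlip : LipschitzOnWith (Real.toNNReal (-ε b)⁻¹) (fun y : ℝ ↦ Real.log (-y)) (Iic (ε b)) := by
    refine LipschitzOnWith.of_dist_le_mul fun x hx y hy ↦ ?_
    show dist (Real.log (-x)) (Real.log (-y)) ≤ _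
    rw [Real.coe_toNNReal _ (inv_nonneg.2 hpos.le)]
    have hx' : -ε b ≤ -x := neg_le_neg hx
    have hy' : -ε b ≤ -y := neg_le_neg hy
    have h := dist_log_le_inv_mul_dist hpos hx' hy'
    rw [dist_neg_neg] at h
    exact h
  have hmaps : MapsTo weilGroundEnergy (uIcc b a) (Iic (ε b)) := by
    intro x hx
    rw [uIcc_of_le hba] at hx
    exact weilGroundEnergy_antitone_of_pos' hb hx.1
  have hcomp :=
    (weilGroundEnergy_absolutelyContinuousOnInterval hb hba).comp_of_lipschitzOnWith hlip hmaps
  beta_reduce at hcomp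
  exact hcomp

/-- The leakage identity on the negative side: for `0 < b ≤ a` with `ε b < 0` the rate
`C₀ = -(log ∘ (-ε))'` is integrable on `[b, a]` and `ε b · exp (-∫_b^a C₀) = ε a` exactly. [DecompCensus §F2] -/
theorem leakage_identity_of_neg {b a : ℝ} (hb : 0 < b) (hba : b ≤ a) (hεb : ε b < 0) :
    IntervalIntegrable (fun x ↦ -deriv (fun y ↦ Real.log (-ε y)) x) volume b a ∧
      ε b * Real.exp (-(∫ x in b..a, -deriv (fun y ↦ Real.log (-ε y)) x)) = ε a := by
  have hAC := logNegAC_of_neg_left hb hba hεb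
  have hεa : ε a < 0 := lt_of_le_of_lt (weilGroundEnergy_antitone_of_pos' hb hba) hεb
  refine ⟨hAC.intervalIntegrable_deriv.neg, ?_⟩
  rw [intervalIntegral.integral_neg, neg_neg, hAC.integral_deriv_eq_sub, Real.exp_sub,
    Real.exp_log (neg_pos.2 hεa), Real.exp_log (neg_pos.2 hεb), neg_div_neg_eq,
    mul_div_cancel₀ _ hεb.ne]

/-- **Certificate of the residual** (honest label): the tail piece is EXACTLY "head ⟹ RH".
(→) is the composition; (←) if RH then `X` and restrict; if ¬RH then the head fails, so `ε a₁ < 0`,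
`ε < 0` on `[a₁, ∞)` and the law holds there with the canonical negative-side rate. [DecompCensus §F2] -/
theorem tailLeakage_iff_head_imp_rh {a₁ : ℝ} (ha₁ : 0 < a₁) :
    TailLeakage a₁ ↔ (HeadRung a₁ → _root_.RiemannHypothesis) := by
  constructor
  · intro hT hH
    exact gronwallLeakage_iff_riemannHypothesis.1 (gronwallLeakage_of_head_tail ha₁ hH hT)
  · intro h
    by_cases hRH : _root_.RiemannHypothesis
    · exact tailLeakage_of_gronwallLeakage ha₁ (gronwallLeakage_iff_riemannHypothesis.2 hRH)
    · have hH : ¬ HeadRung a₁ := fun hH ↦ hRH (h hH)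
      have hneg : ε a₁ < 0 := by
        by_contra hnn
        push Not at hnn
        exact hH ((weilGroundEnergy_nonneg_iff_holds ha₁).1 hnn)
      refine ⟨fun x ↦ -deriv (fun y ↦ Real.log (-ε y)) x, fun b a hb hba ↦ ?_⟩
      have hb0 : 0 < b := ha₁.trans_le hb
      have hεb : ε b < 0 := lt_of_le_of_lt (weilGroundEnergy_antitone_of_pos' ha₁ hb) hneg
      obtain ⟨hint, heq⟩ := leakage_identity_of_neg hb0 hba hεb
      exact ⟨hint, heq.le⟩

/-- **F8 — the residual is `NextRung → RH`, no more, no less.** -/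
theorem residual_iff : ResidualLog2 ↔ (NextRung → _root_.RiemannHypothesis) :=
  tailLeakage_iff_head_imp_rh (Real.log_pos one_lt_two)

/-- **F8 — conjunct split certificate:** the two stubs are JOINTLY the summit (and each separately a
consequence of it: `nextRung_of_riemannHypothesis`, `residual_of_gronwallLeakage ∘ (X ↔ RH).2`). -/
theorem nextRung_and_residual_iff : (NextRung ∧ ResidualLog2) ↔ _root_.RiemannHypothesis := by
  constructor
  · rintro ⟨hH, hT⟩
    exact gronwallLeakage_iff_riemannHypothesis.1 (GronwallLeakage_of hH hT)
  · intro h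
    exact ⟨nextRung_of_riemannHypothesis h,
      residual_of_gronwallLeakage (gronwallLeakage_iff_riemannHypothesis.2 h)⟩

/-! ## §6 The attack on the rung: two-prime analytic form and the certificate entry point -/

/-- **Reduction (landed):** the next rung is `E₂₃(g) ≥ 0` on `C(log 2)`. -/
theorem nextRung_iff_twoPrime :
    NextRung ↔ ∀ g : ℝ → ℂ, IsWeilTest g → tsupport g ⊆ Icc (-Real.log 2) (Real.log 2) →
      0 ≤ weilTwoPrimeQuadratic g :=
  weilPositivityOn_log_two_iff

/-- **Enclosure step:** `E₂₃ ≥ 0` on any LARGER cone `C(b)`, `b ≥ log 2` (e.g. a rational / dyadic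
`b`), gives the next rung — `E₂₃` is a form on all test functions, so the irrational endpoint costs nothing. -/
theorem nextRung_of_twoPrime_on {b : ℝ} (hb : Real.log 2 ≤ b)
    (h : ∀ g : ℝ → ℂ, IsWeilTest g → tsupport g ⊆ Icc (-b) b → 0 ≤ weilTwoPrimeQuadratic g) :
    NextRung :=
  nextRung_iff_twoPrime.2 fun g hg hsupp ↦
    h g hg (hsupp.trans (Icc_subset_Icc (neg_le_neg hb) hb))

/-- **Certificate entry point:** one instance of the proved-sound two-prime Yoshida moment format
`WeilCert23` with `check = true` and support parameter `b ≥ log 2` closes STUB 1. -/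
theorem nextRung_of_cert (c : WeilCert23) (hc : c.check = true) (hb : Real.log 2 ≤ ((c.b : ℚ) : ℝ)) :
    NextRung :=
  nextRung_of_twoPrime_on hb fun _ hg hsupp ↦ WeilCert23.weilTwoPrimeQuadratic_nonneg_of_check hc hg hsupp

/-- The suggested dyadic enclosure: `log 2 ≤ 355/512` (`= 0.693359…`, excess `2.1·10⁻⁴`; the floor used
`563/1024` above `(log 3)/2` with excess `5.0·10⁻⁴`). -/
theorem log_two_le_dyadic : Real.log 2 ≤ ((355 / 512 : ℚ) : ℝ) := by
  have h := Real.log_two_lt_d9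
  push_cast
  linarith

/-- Hence a certificate at `b = 355/512` suffices. -/
theorem nextRung_of_cert_dyadic (c : WeilCert23) (hc : c.check = true) (hb : c.b = 355 / 512) :
    NextRung :=
  nextRung_of_cert c hc (by rw [hb]; exact log_two_le_dyadic)

end Summit.RiemannHypothesis.RiemannHypothesis.Cruxes.GronwallLeakage.ExactRungLog2

end
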